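import Literature.NumberTheory.EllipticCurves.WeierstrassZWChart
import HarnessLib

/-!
# Points of the two charts of a Weierstrass cubic with values in an algebra

For a Weierstrass equation `W` over `R` and an `R`-algebra `S`, the `S`-valued points of the
two affine charts of the Weierstrass cubic `E_W` — i.e. the `R`-algebra homomorphisms out of
their coordinate rings — are the solutions of the chart equations in `S`:

* affine chart `U₁ = Spec R[W]`: `Hom_R(R[W], S) ≃ {(x, y) ∈ S² | W_S(x, y) = 0}`
  (`affineEval`, `affineAlgHomEquiv`; Silverman, *AEC* III.1: the affine points);
* chart at `O`, `U₂ = Spec R[W]_O`: `Hom_R(R[W]_O, S) ≃ {(z, w) ∈ S² | G_S(z, w) = 0}`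
  (`zwEval`, `zwAlgHomEquiv`; AEC IV.1), the point `O` being `(z, w) = (0, 0)` (`zwEvalZero`);
* the transition on points: an affine point `(x, y)` with `y` a unit is the point
  `(z, w) = (-x/y, -1/y)` of the chart at `O` (`zwToAway` followed by the extension of the
  evaluation to `R[W][1/y]`; `liftAwayY_comp_zwToAway`), and a point `(z, w)` of the chart at
  `O` with `w` a unit is the affine point `(x, y) = (z/w, -1/w)` (`liftAwayW_comp_toZWAway`).

These are the ring-theoretic halves of the description of the field-valued points of the
scheme `E_W` (a morphism from the spectrum of a field, or of a local ring, factors through one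
of the two charts).

## References

* [SilvermanAEC2009] J. H. Silverman, *The Arithmetic of Elliptic Curves*, 2nd ed., GTM 106,
  Springer 2009, III.1 (points of the Weierstrass cubic: the affine points and `O`), IV.1
  (`z = -x/y`, `w = -1/y`).

## Design

* Points are `R`-algebra homomorphisms (`→ₐ[R]`), built with `AdjoinRoot.liftAlgHom` over the
  coefficient ring `R[X]` of the bivariate presentation; the defining equations are checked in
  the explicit (expanded) form, so that no lemma about `Polynomial.map`/`evalEval` interplay
  is needed.
* Declarations are deliberate dot-notation extensions in `namespace WeierstrassCurve`.
-/

noncomputable section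

open Polynomial
open scoped Polynomial.Bivariate

universe u v

namespace WeierstrassCurve

variable {R : Type u} [CommRing R] (W : WeierstrassCurve R) {S : Type v} [CommRing S]
  [Algebra R S]

/-! ## Points of the affine chart -/

/-- The Weierstrass equation over an `R`-algebra, expanded. [folklore] -/
theorem equation_baseChange_iff (x y : S) : (W.baseChange S).toAffine.Equation x y ↔
    y ^ 2 + algebraMap R S W.a₁ * x * y + algebraMap R S W.a₃ * y
      - (x ^ 3 + algebraMap R S W.a₂ * x ^ 2 + algebraMap R S W.a₄ * x
        + algebraMap R S W.a₆) = 0 := by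
  rw [Affine.equation_iff']
  rfl

/-- **The `S`-valued point `(x, y)` of the affine chart as an `R`-algebra homomorphism**
`R[W] → S`, `x̄ ↦ x`, `ȳ ↦ y` (evaluation at an affine point; Silverman, *AEC* III.1).
[cite: SilvermanAEC2009, III.1] -/
def affineEval (x y : S) (h : (W.baseChange S).toAffine.Equation x y) :
    W.toAffine.CoordinateRing →ₐ[R] S :=
  AdjoinRoot.liftAlgHom W.toAffine.polynomial (aeval x : R[X] →ₐ[R] S) y <| by
    rw [equation_baseChange_iff] at h
    simp only [Affine.polynomial, eval₂_add, eval₂_sub, eval₂_mul, eval₂_pow, eval₂_C, eval₂_X,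
      AlgHom.coe_toRingHom, map_add, map_mul, map_pow, aeval_C, aeval_X]
    linear_combination h

/-- `affineEval` sends `x̄` to `x`. [folklore] -/
@[simp]
theorem affineEval_xClass (x y : S) (h : (W.baseChange S).toAffine.Equation x y) :
    W.affineEval x y h (xClass W) = x := by
  rw [affineEval, xClass, AdjoinRoot.coe_liftAlgHom, AdjoinRoot.lift_mk, eval₂_C,
    AlgHom.toRingHom_eq_coe, AlgHom.coe_toRingHom, aeval_X]

/-- `affineEval` sends `ȳ` to `y`. [folklore] -/
@[simp]
theorem affineEval_yClass (x y : S) (h : (W.baseChange S).toAffine.Equation x y) :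
    W.affineEval x y h (yClass W) = y := by
  rw [affineEval, yClass, AdjoinRoot.coe_liftAlgHom, AdjoinRoot.lift_mk, eval₂_X]

/-- `R`-algebra homomorphisms out of `R[W]` are determined by the images of `x̄` and `ȳ`.
[folklore] -/
theorem affine_algHom_ext {φ ψ : W.toAffine.CoordinateRing →ₐ[R] S}
    (hx : φ (xClass W) = ψ (xClass W)) (hy : φ (yClass W) = ψ (yClass W)) : φ = ψ := by
  refine Ideal.Quotient.algHom_ext _ (Polynomial.algHom_ext' (Polynomial.algHom_ext ?_) ?_)
  · exact hx
  · exact hy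

/-- The images of `x̄, ȳ` under an `R`-algebra homomorphism `R[W] → S` satisfy the Weierstrass
equation over `S`. [folklore] -/
theorem equation_algHom (φ : W.toAffine.CoordinateRing →ₐ[R] S) :
    (W.baseChange S).toAffine.Equation (φ (xClass W)) (φ (yClass W)) := by
  rw [equation_baseChange_iff]
  have h := congrArg φ (xy_relation W)
  simp only [map_add, map_sub, map_mul, map_pow, map_zero, AlgHom.commutes] at h
  exact h

/-- **The `S`-valued points of the affine chart are the solutions of the Weierstrass equation
in `S`**: `Hom_R(R[W], S) ≃ {(x, y) ∈ S² | W_S(x, y) = 0}` (Silverman, *AEC* III.1).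
[cite: SilvermanAEC2009, III.1] -/
def affineAlgHomEquiv : (W.toAffine.CoordinateRing →ₐ[R] S) ≃
    {xy : S × S // (W.baseChange S).toAffine.Equation xy.1 xy.2} where
  toFun φ := ⟨(φ (xClass W), φ (yClass W)), W.equation_algHom φ⟩
  invFun xy := W.affineEval xy.1.1 xy.1.2 xy.2
  left_inv _ := W.affine_algHom_ext (W.affineEval_xClass _ _ _) (W.affineEval_yClass _ _ _)
  right_inv _ := Subtype.ext (Prod.ext (W.affineEval_xClass _ _ _) (W.affineEval_yClass _ _ _))

/-! ## Points of the chart at `O` -/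

/-- The chart equation at `O` over an `R`-algebra, expanded. [cite: SilvermanAEC2009, IV.1] -/
theorem zwEquation_baseChange_iff (z w : S) : (W.baseChange S).ZWEquation z w ↔
    z ^ 3 + algebraMap R S W.a₁ * z * w + algebraMap R S W.a₂ * z ^ 2 * w
      + algebraMap R S W.a₃ * w ^ 2 + algebraMap R S W.a₄ * z * w ^ 2
      + algebraMap R S W.a₆ * w ^ 3 - w = 0 :=
  W.zwEquation_map_iff (algebraMap R S) z w

/-- **The `S`-valued point `(z, w)` of the chart at `O` as an `R`-algebra homomorphism**
`R[W]_O → S`, `z̄ ↦ z`, `w̄ ↦ w` (Silverman, *AEC* IV.1). [cite: SilvermanAEC2009, IV.1] -/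
def zwEval (z w : S) (h : (W.baseChange S).ZWEquation z w) : W.ZWCoordinateRing →ₐ[R] S :=
  AdjoinRoot.liftAlgHom W.zwPolynomial (aeval w : R[X] →ₐ[R] S) z <| by
    rw [zwEquation_baseChange_iff] at h
    simp only [zwPolynomial, eval₂_add, eval₂_sub, eval₂_mul, eval₂_pow, eval₂_C, eval₂_X,
      AlgHom.coe_toRingHom, map_add, map_sub, map_mul, map_pow, aeval_C, aeval_X]
    linear_combination h

/-- `zwEval` sends `z̄` to `z`. [folklore] -/
@[simp]
theorem zwEval_zClass (z w : S) (h : (W.baseChange S).ZWEquation z w) :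
    W.zwEval z w h (ZWCoordinateRing.zClass W) = z := by
  rw [zwEval, ZWCoordinateRing.zClass, AdjoinRoot.coe_liftAlgHom, AdjoinRoot.lift_mk, eval₂_X]

/-- `zwEval` sends `w̄` to `w`. [folklore] -/
@[simp]
theorem zwEval_wClass (z w : S) (h : (W.baseChange S).ZWEquation z w) :
    W.zwEval z w h (ZWCoordinateRing.wClass W) = w := by
  rw [zwEval, ZWCoordinateRing.wClass, AdjoinRoot.coe_liftAlgHom, AdjoinRoot.lift_mk, eval₂_C,
    AlgHom.toRingHom_eq_coe, AlgHom.coe_toRingHom, aeval_X]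

/-- `R`-algebra homomorphisms out of `R[W]_O` are determined by the images of `z̄` and `w̄`.
[folklore] -/
theorem zw_algHom_ext {φ ψ : W.ZWCoordinateRing →ₐ[R] S}
    (hz : φ (ZWCoordinateRing.zClass W) = ψ (ZWCoordinateRing.zClass W))
    (hw : φ (ZWCoordinateRing.wClass W) = ψ (ZWCoordinateRing.wClass W)) : φ = ψ := by
  refine Ideal.Quotient.algHom_ext _ (Polynomial.algHom_ext' (Polynomial.algHom_ext ?_) ?_)
  · exact hw
  · exact hz

/-- The images of `z̄, w̄` under an `R`-algebra homomorphism `R[W]_O → S` satisfy the chart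
equation over `S`. [folklore] -/
theorem zwEquation_algHom (φ : W.ZWCoordinateRing →ₐ[R] S) :
    (W.baseChange S).ZWEquation (φ (ZWCoordinateRing.zClass W)) (φ (ZWCoordinateRing.wClass W)) := by
  rw [zwEquation_baseChange_iff]
  have h := congrArg φ (ZWCoordinateRing.zw_relation W)
  simp only [map_add, map_sub, map_mul, map_pow, map_zero, AlgHom.commutes] at h
  exact h

/-- **The `S`-valued points of the chart at `O` are the solutions of its equation in `S`**:
`Hom_R(R[W]_O, S) ≃ {(z, w) ∈ S² | G_S(z, w) = 0}` (Silverman, *AEC* IV.1).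
[cite: SilvermanAEC2009, IV.1] -/
def zwAlgHomEquiv : (W.ZWCoordinateRing →ₐ[R] S) ≃
    {zw : S × S // (W.baseChange S).ZWEquation zw.1 zw.2} where
  toFun φ := ⟨(φ (ZWCoordinateRing.zClass W), φ (ZWCoordinateRing.wClass W)),
    W.zwEquation_algHom φ⟩
  invFun zw := W.zwEval zw.1.1 zw.1.2 zw.2
  left_inv _ := W.zw_algHom_ext (W.zwEval_zClass _ _ _) (W.zwEval_wClass _ _ _)
  right_inv _ := Subtype.ext (Prod.ext (W.zwEval_zClass _ _ _) (W.zwEval_wClass _ _ _))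

/-- **The point `O`** with values in any `R`-algebra `S`: `(z, w) = (0, 0)` (AEC IV.1: in the
chart at `O`, "`O` is the point `(z, w) = (0, 0)`"). [cite: SilvermanAEC2009, IV.1] -/
def zwEvalZero (S : Type v) [CommRing S] [Algebra R S] : W.ZWCoordinateRing →ₐ[R] S :=
  W.zwEval 0 0 ((W.baseChange S).zwEquation_zero)

/-- `O` has `z = 0`. [cite: SilvermanAEC2009, IV.1] -/
@[simp]
theorem zwEvalZero_zClass (S : Type v) [CommRing S] [Algebra R S] :
    W.zwEvalZero S (ZWCoordinateRing.zClass W) = 0 :=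
  W.zwEval_zClass 0 0 _

/-- `O` has `w = 0`. [cite: SilvermanAEC2009, IV.1] -/
@[simp]
theorem zwEvalZero_wClass (S : Type v) [CommRing S] [Algebra R S] :
    W.zwEvalZero S (ZWCoordinateRing.wClass W) = 0 :=
  W.zwEval_wClass 0 0 _

/-- A point `(z, w)` of the chart at `O` with `w = 0` is `O = (0, 0)`, provided `S` is reduced
(from `w = 0` the chart equation gives `z³ = 0`). [cite: SilvermanAEC2009, IV.1] -/
theorem eq_zero_of_zwEquation_of_w_eq_zero [IsReduced S] {z w : S}
    (h : (W.baseChange S).ZWEquation z w) (hw : w = 0) : z = 0 := by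
  subst hw
  rw [zwEquation_baseChange_iff] at h
  have h3 : z ^ 3 = 0 := by linear_combination h
  exact IsReduced.eq_zero z ⟨3, h3⟩

/-! ## The chart transition on points -/

/-- `zwToAway` as an `R`-algebra homomorphism `R[W]_O →ₐ[R] R[W][1/y]`. [cite: SilvermanAEC2009, IV.1] -/
def zwToAwayₐ : W.ZWCoordinateRing →ₐ[R] W.AwayY :=
  { W.zwToAway with commutes' := W.zwToAway_algebraMap }

/-- Underlying ring homomorphism of `zwToAwayₐ`. [folklore] -/
@[simp]
theorem coe_zwToAwayₐ : (W.zwToAwayₐ : W.ZWCoordinateRing →+* W.AwayY) = W.zwToAway := rfl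

/-- `zwToAwayₐ` is `zwToAway`. [folklore] -/
@[simp]
theorem zwToAwayₐ_apply (b : W.ZWCoordinateRing) : W.zwToAwayₐ b = W.zwToAway b := rfl

/-- `toZWAway` as an `R`-algebra homomorphism `R[W] →ₐ[R] R[W]_O[1/w]`. [cite: SilvermanAEC2009, IV.1] -/
def toZWAwayₐ : W.toAffine.CoordinateRing →ₐ[R] W.AwayW :=
  { W.toZWAway with commutes' := W.toZWAway_algebraMap }

/-- Underlying ring homomorphism of `toZWAwayₐ`. [folklore] -/
@[simp]
theorem coe_toZWAwayₐ : (W.toZWAwayₐ : W.toAffine.CoordinateRing →+* W.AwayW) = W.toZWAway := rfl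

/-- `toZWAwayₐ` is `toZWAway`. [folklore] -/
@[simp]
theorem toZWAwayₐ_apply (a : W.toAffine.CoordinateRing) : W.toZWAwayₐ a = W.toZWAway a := rfl

section ToZW

variable (x y : S) (h : (W.baseChange S).toAffine.Equation x y) (hy : IsUnit y)

include hy in
/-- At an affine point `(x, y)` with `y` a unit, the evaluation sends `ȳ` to a unit. [folklore] -/
theorem isUnit_affineEval_yClass : IsUnit (W.affineEval x y h (yClass W)) := by
  rwa [affineEval_yClass]

/-- The extension of the evaluation at an affine point `(x, y)` with `y` a unit to
`R[W][1/y] →ₐ[R] S`. [folklore] -/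
def liftAwayY : W.AwayY →ₐ[R] S :=
  IsLocalization.Away.liftAlgHom (yClass W) (f := W.affineEval x y h)
    (W.isUnit_affineEval_yClass x y h hy)

/-- `liftAwayY` extends `affineEval`. [folklore] -/
@[simp]
theorem liftAwayY_algebraMap (a : W.toAffine.CoordinateRing) :
    W.liftAwayY x y h hy (algebraMap _ W.AwayY a) = W.affineEval x y h a := by
  rw [liftAwayY, IsLocalization.Away.liftAlgHom_apply, IsLocalization.Away.lift_eq]
  rfl

/-- The extended evaluation sends `y⁻¹` to `y⁻¹`. [folklore] -/
theorem liftAwayY_invSelf :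
    W.liftAwayY x y h hy (IsLocalization.Away.invSelf (yClass W)) = ↑hy.unit⁻¹ := by
  have h1 := congrArg (W.liftAwayY x y h hy) (IsLocalization.Away.mul_invSelf (S := W.AwayY)
    (yClass W))
  rw [map_mul, map_one, liftAwayY_algebraMap, affineEval_yClass] at h1
  calc W.liftAwayY x y h hy (IsLocalization.Away.invSelf (yClass W))
      = (↑hy.unit⁻¹ * ↑hy.unit) * W.liftAwayY x y h hy (IsLocalization.Away.invSelf (yClass W)) := by
        rw [Units.inv_mul, one_mul]
    _ = ↑hy.unit⁻¹ * (y * W.liftAwayY x y h hy (IsLocalization.Away.invSelf (yClass W))) := by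
        rw [mul_assoc, hy.unit_spec]
    _ = ↑hy.unit⁻¹ := by rw [h1, mul_one]

/-- **An affine point `(x, y)` with `y` a unit is the point `(z, w) = (-x/y, -1/y)` of the chart
at `O`**: `R[W]_O → R[W][1/y] → S` is the evaluation at `(-x·y⁻¹, -y⁻¹)` (Silverman, *AEC*
IV.1: `z = -x/y`, `w = -1/y`). [cite: SilvermanAEC2009, IV.1] -/
theorem liftAwayY_comp_zwToAway_apply :
    (W.liftAwayY x y h hy).comp W.zwToAwayₐ (ZWCoordinateRing.zClass W) = -(x * ↑hy.unit⁻¹) ∧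
      (W.liftAwayY x y h hy).comp W.zwToAwayₐ (ZWCoordinateRing.wClass W) = -↑hy.unit⁻¹ := by
  constructor
  · rw [AlgHom.comp_apply, zwToAwayₐ_apply, zwToAway_zClass, map_neg, map_mul,
      liftAwayY_algebraMap, affineEval_xClass, liftAwayY_invSelf]
  · rw [AlgHom.comp_apply, zwToAwayₐ_apply, zwToAway_wClass, map_neg, liftAwayY_invSelf]

include h in
/-- The chart-at-`O` coordinates `(-x/y, -1/y)` of an affine point with `y` a unit satisfy the
chart equation. [cite: SilvermanAEC2009, IV.1] -/
theorem zwEquation_of_equation_of_isUnit :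
    (W.baseChange S).ZWEquation (-(x * ↑hy.unit⁻¹)) (-↑hy.unit⁻¹) := by
  obtain ⟨hz, hw⟩ := W.liftAwayY_comp_zwToAway_apply x y h hy
  rw [← hz, ← hw]
  exact W.zwEquation_algHom _

/-- The transition on points, as an identity of `R`-algebra homomorphisms `R[W]_O → S`.
[cite: SilvermanAEC2009, IV.1] -/
theorem liftAwayY_comp_zwToAway :
    (W.liftAwayY x y h hy).comp W.zwToAwayₐ =
      W.zwEval (-(x * ↑hy.unit⁻¹)) (-↑hy.unit⁻¹) (W.zwEquation_of_equation_of_isUnit x y h hy) := by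
  obtain ⟨hz, hw⟩ := W.liftAwayY_comp_zwToAway_apply x y h hy
  exact W.zw_algHom_ext (by rw [hz, zwEval_zClass]) (by rw [hw, zwEval_wClass])

end ToZW

section FromZW

variable (z w : S) (h : (W.baseChange S).ZWEquation z w) (hw : IsUnit w)

include hw in
/-- At a point `(z, w)` of the chart at `O` with `w` a unit, the evaluation sends `w̄` to a unit.
[folklore] -/
theorem isUnit_zwEval_wClass : IsUnit (W.zwEval z w h (ZWCoordinateRing.wClass W)) := by
  rwa [zwEval_wClass]

/-- The extension of the evaluation at a point `(z, w)` of the chart at `O` with `w` a unit to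
`R[W]_O[1/w] →ₐ[R] S`. [folklore] -/
def liftAwayW : W.AwayW →ₐ[R] S :=
  IsLocalization.Away.liftAlgHom (ZWCoordinateRing.wClass W) (f := W.zwEval z w h)
    (W.isUnit_zwEval_wClass z w h hw)

/-- `liftAwayW` extends `zwEval`. [folklore] -/
@[simp]
theorem liftAwayW_algebraMap (b : W.ZWCoordinateRing) :
    W.liftAwayW z w h hw (algebraMap _ W.AwayW b) = W.zwEval z w h b := by
  rw [liftAwayW, IsLocalization.Away.liftAlgHom_apply, IsLocalization.Away.lift_eq]
  rfl

/-- The extended evaluation sends `w⁻¹` to `w⁻¹`. [folklore] -/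
theorem liftAwayW_invSelf :
    W.liftAwayW z w h hw (IsLocalization.Away.invSelf (ZWCoordinateRing.wClass W)) = ↑hw.unit⁻¹ := by
  have h1 := congrArg (W.liftAwayW z w h hw) (IsLocalization.Away.mul_invSelf (S := W.AwayW)
    (ZWCoordinateRing.wClass W))
  rw [map_mul, map_one, liftAwayW_algebraMap, zwEval_wClass] at h1
  calc W.liftAwayW z w h hw (IsLocalization.Away.invSelf (ZWCoordinateRing.wClass W))
      = (↑hw.unit⁻¹ * ↑hw.unit) *
          W.liftAwayW z w h hw (IsLocalization.Away.invSelf (ZWCoordinateRing.wClass W)) := by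
        rw [Units.inv_mul, one_mul]
    _ = ↑hw.unit⁻¹ *
          (w * W.liftAwayW z w h hw (IsLocalization.Away.invSelf (ZWCoordinateRing.wClass W))) := by
        rw [mul_assoc, hw.unit_spec]
    _ = ↑hw.unit⁻¹ := by rw [h1, mul_one]

/-- **A point `(z, w)` of the chart at `O` with `w` a unit is the affine point
`(x, y) = (z/w, -1/w)`**: `R[W] → R[W]_O[1/w] → S` is the evaluation at `(z·w⁻¹, -w⁻¹)`
(Silverman, *AEC* IV.1: `x = z/w`, `y = -1/w`). [cite: SilvermanAEC2009, IV.1] -/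
theorem liftAwayW_comp_toZWAway_apply :
    (W.liftAwayW z w h hw).comp W.toZWAwayₐ (xClass W) = z * ↑hw.unit⁻¹ ∧
      (W.liftAwayW z w h hw).comp W.toZWAwayₐ (yClass W) = -↑hw.unit⁻¹ := by
  constructor
  · rw [AlgHom.comp_apply, toZWAwayₐ_apply, toZWAway_xClass, map_mul, liftAwayW_algebraMap,
      zwEval_zClass, liftAwayW_invSelf]
  · rw [AlgHom.comp_apply, toZWAwayₐ_apply, toZWAway_yClass, map_neg, liftAwayW_invSelf]

include h in
/-- The affine coordinates `(z/w, -1/w)` of a point of the chart at `O` with `w` a unit satisfy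
the Weierstrass equation. [cite: SilvermanAEC2009, IV.1] -/
theorem equation_of_zwEquation_of_isUnit :
    (W.baseChange S).toAffine.Equation (z * ↑hw.unit⁻¹) (-↑hw.unit⁻¹) := by
  obtain ⟨hx, hy⟩ := W.liftAwayW_comp_toZWAway_apply z w h hw
  rw [← hx, ← hy]
  exact W.equation_algHom _

/-- The transition on points, as an identity of `R`-algebra homomorphisms `R[W] → S`.
[cite: SilvermanAEC2009, IV.1] -/
theorem liftAwayW_comp_toZWAway :
    (W.liftAwayW z w h hw).comp W.toZWAwayₐ =
      W.affineEval (z * ↑hw.unit⁻¹) (-↑hw.unit⁻¹) (W.equation_of_zwEquation_of_isUnit z w h hw) := by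
  obtain ⟨hx, hy⟩ := W.liftAwayW_comp_toZWAway_apply z w h hw
  exact W.affine_algHom_ext (by rw [hx, affineEval_xClass]) (by rw [hy, affineEval_yClass])

end FromZW

end WeierstrassCurve
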